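import Summits.Ventures.PercRepro.Reach
import Summits.Ventures.PercRepro.LineC
import Summits.Ventures.PercRepro.MinorC011

/-!
# PercRepro — the CONTRACTION AVERAGE on classes, C-011's induction target of record (p1, gen 4; lead (fr)/(gd) 15:16–15:31Z)

typer-2's `faceSumC011 m u v` (MinorC011.lean) is the C-011 class sum of the class `[v, u]` — the antipodal `K⁺`-sum over the
face cube, equal to `good − bad − liability` of `C011.lean` (`faceSumC011_eq_counts`) and to the full-cube class sum of the marked
minor (`faceSumC011_eq_minor`).  **`ClassContractionAverage`** (CA) is the lead's §10.21.5
contraction average on every class: the sum of the class sums of the classes with one free edge made SURE is at most the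
number of free edges times the class sum — `m·CS(G) ≥ Σ_e CS(G/e)` on every minor (proofs/P1-M-census.md §5: fibre-wise
nonnegative up to (LOC) on 0.03 % of the fibres at n = 6).  (CA) gives Lemma B⁺ on every class by strong induction on the
number of free edges (`faceSumC011_nonneg_of_classContractionAverage`), hence `LemmaBPlus` (`LemmaBPlus_of_classContractionAverage`),
hence C-011 / C-005 at every `p` through typer-2's antipodal principle.  The single-edge form (`ClassContractionMonoC011`) implies (CA).
-/

namespace PercRepro

open Finset

/-- The C-011 kernel vanishes on the diagonal. -/
theorem phiPlusKernel_self (s : Fin 15) : phiPlusKernel s s = 0 := by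
  rw [phiPlusKernel_eq_kplusZ]
  exact_mod_cast (by decide : ∀ s : Fin 15, kplusZ s s = 0) s

namespace MultiGraph

variable {V E : Type*} (G : MultiGraph V E) [Fintype E] [DecidableEq E]

/-- The row map of the class `[v, u]`. -/
noncomputable abbrev classRow (m : Fin 4 → V) (u v : Config E) : Config (Face u v) → Fin 15 :=
  fun ρ => row4 (G.markedPartition (embed u v ρ) m)

/-- The class sum is `good − bad − liability` of the class. -/
theorem faceSumC011_eq_counts (m : Fin 4 → V) (u v : Config E) :
    G.faceSumC011 m u v =
      (goodCount (G.classRow m u v) : ℝ) - badCount (G.classRow m u v) - liabilityCount (G.classRow m u v) :=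
  sum_phiPlusKernel_compl _

/-- A class with no free edge has class sum `0`. -/
theorem faceSumC011_eq_zero_of_isEmpty (m : Fin 4 → V) (u v : Config E) [IsEmpty (Face u v)] :
    G.faceSumC011 m u v = 0 := by
  unfold faceSumC011
  refine Finset.sum_eq_zero fun ρ _ => ?_
  have hρ : ρᶜ = ρ := funext fun e => (IsEmpty.false e).elim
  rw [hρ, phiPlusKernel_self]

/-- The free edges of a class, as a `Finset`. -/
noncomputable def freeOf (u v : Config E) : Finset E := univ.filter fun e => v e = false ∧ u e = true

omit [DecidableEq E] in
/-- The number of free edges is the size of the face cube's coordinate set. -/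
theorem card_freeOf (u v : Config E) : (freeOf u v).card = Fintype.card (Face u v) := by
  rw [Fintype.card_subtype]
  rfl

omit [Fintype E] in
/-- Making a free edge sure keeps the class inside `[·, u]`. -/
theorem update_le_of_le {u v : Config E} (hvu : v ≤ u) {e : E} (hu : u e = true) :
    Function.update v e true ≤ u := by
  intro x
  by_cases hx : x = e
  · subst hx
    rw [Function.update_self, hu]
  · rw [Function.update_of_ne hx]
    exact hvu x

/-- **Lemma B⁺ on classes is the nonnegativity of the class sums.** -/
theorem lemmaBPlus_iff_faceSumC011_nonneg :
    LemmaBPlus ↔ ∀ {V E : Type} [Fintype E] [DecidableEq E] (G : MultiGraph V E) (a b c d : V)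
      (u v : Config E), v ≤ u → 0 ≤ G.faceSumC011 ![a, b, c, d] u v := by
  constructor
  · intro h V E _ _ G a b c d u v hvu
    rw [G.faceSumC011_eq_counts]
    have := h G a b c d u v hvu
    have h' : ((badCount (G.classRow ![a, b, c, d] u v) + liabilityCount (G.classRow ![a, b, c, d] u v) : ℕ) : ℝ) ≤
        (goodCount (G.classRow ![a, b, c, d] u v) : ℝ) := by exact_mod_cast this
    push_cast at h'
    linarith
  · intro h V E _ _ G a b c d u v hvu
    have := h G a b c d u v hvu
    rw [G.faceSumC011_eq_counts] at this
    have h' : ((badCount (G.classRow ![a, b, c, d] u v) + liabilityCount (G.classRow ![a, b, c, d] u v) : ℕ) : ℝ) ≤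
        (goodCount (G.classRow ![a, b, c, d] u v) : ℝ) := by push_cast; linarith
    exact_mod_cast h'

end MultiGraph

/-- **(CA) — THE CONTRACTION AVERAGE ON CLASSES** (the lead's §10.21.5 average form, C-011's induction target of record):
for every class `[v, u]` of every marked multigraph, the sum over the free edges `e` of the class sums of the classes with `e`
made SURE is at most the number of free edges times the class sum of `[v, u]` — i.e. `m·CS(G) ≥ Σ_e CS(G/e)` on every minor. -/
def ClassContractionAverage : Prop :=
  ∀ {V E : Type} [Fintype E] [DecidableEq E] (G : MultiGraph V E) (m : Fin 4 → V) (u v : Config E), v ≤ u →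
    ∑ e ∈ MultiGraph.freeOf u v, G.faceSumC011 m u (Function.update v e true) ≤
      ((MultiGraph.freeOf u v).card : ℝ) * G.faceSumC011 m u v

/-- **(M) for the C-011 kernel on classes, single-edge form**: making any free edge sure does not increase the class sum. -/
def ClassContractionMonoC011 : Prop :=
  ∀ {V E : Type} [Fintype E] [DecidableEq E] (G : MultiGraph V E) (m : Fin 4 → V) (u v : Config E) (e : E),
    v e = false → u e = true → G.faceSumC011 m u (Function.update v e true) ≤ G.faceSumC011 m u v

/-- The single-edge form implies the average. -/
theorem classContractionAverage_of_mono (h : ClassContractionMonoC011) : ClassContractionAverage := by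
  intro V E _ _ G m u v _
  calc ∑ e ∈ MultiGraph.freeOf u v, G.faceSumC011 m u (Function.update v e true)
      ≤ ∑ _e ∈ MultiGraph.freeOf u v, G.faceSumC011 m u v := by
        refine Finset.sum_le_sum fun e he => ?_
        have he' := Finset.mem_filter.1 he
        exact h G m u v e he'.2.1 he'.2.2
    _ = ((MultiGraph.freeOf u v).card : ℝ) * G.faceSumC011 m u v := by
        rw [Finset.sum_const, nsmul_eq_mul]

/-- **(CA) gives Lemma B⁺ on every class** — strong induction on the number of free edges: a class with no free edge
has class sum `0`; otherwise the classes with one free edge made sure have fewer free edges, so their class sums are `≥ 0` by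
the induction hypothesis, and (CA) bounds the class sum below by their average. -/
theorem faceSumC011_nonneg_of_classContractionAverage (h : ClassContractionAverage) :
    ∀ {V E : Type} [Fintype E] [DecidableEq E] (G : MultiGraph V E) (m : Fin 4 → V) (u v : Config E),
      v ≤ u → 0 ≤ G.faceSumC011 m u v := by
  intro V E _ _ G m u v hvu
  suffices key : ∀ n : ℕ, ∀ (u v : Config E), v ≤ u → Fintype.card (Face u v) = n → 0 ≤ G.faceSumC011 m u v
    from key _ u v hvu rfl
  intro n
  induction n using Nat.strong_induction_on with
  | _ n ih =>
    intro u v hvu hcard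
    by_cases hfree : ∃ e, v e = false ∧ u e = true
    · obtain ⟨e₀, hv₀, hu₀⟩ := hfree
      -- the average of the one-edge-sure classes is nonnegative by the induction hypothesis
      have hsum : 0 ≤ ∑ e ∈ MultiGraph.freeOf u v, G.faceSumC011 m u (Function.update v e true) := by
        refine Finset.sum_nonneg fun e he => ?_
        have he' := Finset.mem_filter.1 he
        have hlt := card_face_update_lt u v he'.2.1 he'.2.2
        rw [hcard] at hlt
        exact ih _ hlt u _ (MultiGraph.update_le_of_le hvu he'.2.2) rfl
      have hpos : (0 : ℝ) < ((MultiGraph.freeOf u v).card : ℝ) := by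
        have : e₀ ∈ MultiGraph.freeOf u v := Finset.mem_filter.2 ⟨Finset.mem_univ _, hv₀, hu₀⟩
        exact_mod_cast Finset.card_pos.2 ⟨e₀, this⟩
      have hca := h G m u v hvu
      by_contra hneg
      have hneg' : G.faceSumC011 m u v < 0 := not_le.mp hneg
      have : ((MultiGraph.freeOf u v).card : ℝ) * G.faceSumC011 m u v < 0 := mul_neg_of_pos_of_neg hpos hneg'
      linarith
    · have : IsEmpty (Face u v) := ⟨fun x => hfree ⟨x.1, x.2⟩⟩
      rw [G.faceSumC011_eq_zero_of_isEmpty m u v]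

/-- **(CA) ⇒ Lemma B⁺** (`LemmaBPlus` of `C011.lean`, hence C-011 and C-005 at every `p` through typer-2's antipodal principle). -/
theorem LemmaBPlus_of_classContractionAverage (h : ClassContractionAverage) : LemmaBPlus :=
  (MultiGraph.lemmaBPlus_iff_faceSumC011_nonneg).2 fun G a b c d u v hvu =>
    faceSumC011_nonneg_of_classContractionAverage h G ![a, b, c, d] u v hvu

/-- The single-edge (M) for the C-011 kernel gives Lemma B⁺ as well. -/
theorem LemmaBPlus_of_classContractionMonoC011 (h : ClassContractionMonoC011) : LemmaBPlus :=
  LemmaBPlus_of_classContractionAverage (classContractionAverage_of_mono h)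

end PercRepro
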